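import Mathlib
import Literature.Geometry.Symplectic.JHolomorphicMap
import Summits.SmoothPoincare4.SmoothPoincare4.Theorems.SullivanDualTameOrBrodyR4AprioriCalculus

/-!
# A-priori estimate for `J`-holomorphic maps, part 2: the pointwise source bound

Helper file of the lead (c2) for stub `stub_aprioriOf` of line `Sketch`, crux `TameOrBrodyR4`
(stmt-SmoothPoincare4-7826, route SullivanDual). Faà di Bruno bound for `Dᵏ(J ∘ g)` with the
orders `≤ k - 2` of `g` frozen (linear in `‖Dᵏg‖`, quadratic in `‖D^{k-1}g‖`; from
`norm_iteratedFDeriv_comp_le` with `D = max(S, a_{k-1}^{1/(k-1)}, a_k^{1/k})`), and the resulting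
pointwise bound `source_le` (registered sub-goal) for the commutator source term of the
bootstrapping: `‖Dⁿ((J∘g) ∂₁g)(z) - (J∘g)(z) ∘ Dⁿ∂₁g(z)‖ ≤ C(n, M, S) (1 + ‖D^{n-1}g(z)‖² + ‖Dⁿg(z)‖)`
when `‖DⁱJ‖ ≤ M` at `g z` (`i ≤ n`), `‖D¹g(z)‖ ≤ 2` and `‖Dⁱg(z)‖ ≤ S` for `1 ≤ i ≤ n - 2`, with the
explicit constant `C = ∑_{j<n} C(n,j+1) (j+1)! M (S^{j+1} + 1 + S² + S) (2S)`.
-/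

noncomputable section

open scoped ContDiff Topology Nat
open Filter Set Literature.Geometry.Symplectic

-- the registered namespace `Summit.SmoothPoincare4.SmoothPoincare4.…` repeats a component
set_option linter.dupNamespace false

namespace Summit.SmoothPoincare4.SmoothPoincare4.Cruxes.TameOrBrodyR4.Sketch

namespace Apriori

/-! ### Faà di Bruno bounds for `A = J ∘ g` -/

/-- `(max x y)^k ≤ x^k + y^k` for `x, y ≥ 0`. -/
theorem max_pow_le_add {x y : ℝ} (hx : 0 ≤ x) (hy : 0 ≤ y) (k : ℕ) :
    max x y ^ k ≤ x ^ k + y ^ k := by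
  rcases le_total x y with h | h
  · rw [max_eq_right h]; linarith [pow_nonneg hx k]
  · rw [max_eq_left h]; linarith [pow_nonneg hy k]

/-- `a · a^{1/m} ≤ 1 + a²` for `a ≥ 0`, `m ≥ 1`. -/
theorem mul_rpow_inv_le {a : ℝ} (ha : 0 ≤ a) {m : ℕ} (hm : 1 ≤ m) :
    a * a ^ ((m : ℝ)⁻¹) ≤ 1 + a ^ 2 := by
  have hexp0 : 0 ≤ (m : ℝ)⁻¹ := by positivity
  have hexp1 : (m : ℝ)⁻¹ ≤ 1 := inv_le_one_of_one_le₀ (by exact_mod_cast hm)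
  rcases le_total a 1 with h | h
  · have : a ^ ((m : ℝ)⁻¹) ≤ 1 := Real.rpow_le_one ha h hexp0
    nlinarith [Real.rpow_nonneg ha ((m : ℝ)⁻¹)]
  · have : a ^ ((m : ℝ)⁻¹) ≤ a := by
      conv_rhs => rw [← Real.rpow_one a]
      exact Real.rpow_le_rpow_of_exponent_le h hexp1
    nlinarith

/-- **Faà di Bruno bound, order `k ≥ 2`, with frozen lower orders.** If `‖DⁱJ‖ ≤ M` at `g z` for
`i ≤ k` and `‖Dⁱg(z)‖ ≤ S` (`S ≥ 1`) for `1 ≤ i ≤ k - 2`, then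
`‖Dᵏ(J ∘ g)(z)‖ ≤ k! M (Sᵏ + 1 + ‖D^{k-1}g(z)‖² + ‖Dᵏg(z)‖)` — linear in the top order,
quadratic in the next one (from `norm_iteratedFDeriv_comp_le` with
`D = max(S, a_{k-1}^{1/(k-1)}, a_k^{1/k})`). -/
theorem norm_iteratedFDeriv_comp_le_frozen {E G : Type*} [NormedAddCommGroup E] [NormedSpace ℝ E]
    [NormedAddCommGroup G] [NormedSpace ℝ G] {J : E → G} {g : ℂ → E} (hJ : ContDiff ℝ ∞ J)
    (hg : ContDiff ℝ ∞ g) {k : ℕ} (hk : 2 ≤ k) {M S : ℝ} (hS : 1 ≤ S) (z : ℂ)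
    (hM : ∀ i, i ≤ k → ‖iteratedFDeriv ℝ i J (g z)‖ ≤ M)
    (hlow : ∀ i, 1 ≤ i → i + 2 ≤ k → ‖iteratedFDeriv ℝ i g z‖ ≤ S) :
    ‖iteratedFDeriv ℝ k (fun y => J (g y)) z‖ ≤
      k ! * M * (S ^ k + 1 + ‖iteratedFDeriv ℝ (k - 1) g z‖ ^ 2 + ‖iteratedFDeriv ℝ k g z‖) := by
  set a := ‖iteratedFDeriv ℝ (k - 1) g z‖ with ha
  set b := ‖iteratedFDeriv ℝ k g z‖ with hb
  have ha0 : 0 ≤ a := norm_nonneg _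
  have hb0 : 0 ≤ b := norm_nonneg _
  have hk1 : 1 ≤ k - 1 := by omega
  have hk0 : k ≠ 0 := by omega
  set α := a ^ (((k - 1 : ℕ) : ℝ)⁻¹) with hα
  set β := b ^ (((k : ℕ) : ℝ)⁻¹) with hβ
  have hα0 : 0 ≤ α := Real.rpow_nonneg ha0 _
  have hβ0 : 0 ≤ β := Real.rpow_nonneg hb0 _
  set D := max S (max α β) with hD
  have hD1 : 1 ≤ D := hS.trans (le_max_left _ _)
  have hD0 : 0 ≤ D := zero_le_one.trans hD1
  have hM0 : 0 ≤ M := (norm_nonneg _).trans (hM 0 (Nat.zero_le _))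
  -- the geometric hypothesis of `norm_iteratedFDeriv_comp_le`
  have hDpow : ∀ i, 1 ≤ i → i ≤ k → ‖iteratedFDeriv ℝ i g z‖ ≤ D ^ i := by
    intro i hi1 hik
    rcases Nat.lt_or_ge (i + 1) k with hlt | hge
    · -- `i ≤ k - 2`
      calc ‖iteratedFDeriv ℝ i g z‖ ≤ S := hlow i hi1 (by omega)
        _ ≤ D := le_max_left _ _
        _ ≤ D ^ i := le_self_pow₀ hD1 (by omega)
    · rcases Nat.eq_or_lt_of_le hik with heq | hlt'
      · -- `i = k`
        subst heq
        calc ‖iteratedFDeriv ℝ i g z‖ = b := rfl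
          _ = β ^ i := (Real.rpow_inv_natCast_pow hb0 hk0).symm
          _ ≤ D ^ i := pow_le_pow_left₀ hβ0 ((le_max_right _ _).trans (le_max_right _ _)) i
      · -- `i = k - 1`
        have hi : i = k - 1 := by omega
        subst hi
        calc ‖iteratedFDeriv ℝ (k - 1) g z‖ = a := rfl
          _ = α ^ (k - 1) := (Real.rpow_inv_natCast_pow ha0 (by omega)).symm
          _ ≤ D ^ (k - 1) :=
            pow_le_pow_left₀ hα0 ((le_max_left _ _).trans (le_max_right _ _)) (k - 1)
  have hFdB : ‖iteratedFDeriv ℝ k (J ∘ g) z‖ ≤ k ! * M * D ^ k :=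
    norm_iteratedFDeriv_comp_le (N := ∞) hJ hg (mod_cast le_top) z hM hDpow
  have hcomp : (fun y => J (g y)) = J ∘ g := rfl
  rw [hcomp]
  refine hFdB.trans ?_
  have hDk : D ^ k ≤ S ^ k + 1 + a ^ 2 + b := by
    have h1 : D ^ k ≤ S ^ k + (α ^ k + β ^ k) :=
      calc D ^ k ≤ S ^ k + (max α β) ^ k :=
            max_pow_le_add (zero_le_one.trans hS) (le_max_of_le_left hα0) k
        _ ≤ S ^ k + (α ^ k + β ^ k) := by
            have := max_pow_le_add hα0 hβ0 k
            linarith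
    have h2 : β ^ k = b := Real.rpow_inv_natCast_pow hb0 hk0
    have h3 : α ^ k ≤ 1 + a ^ 2 := by
      have hsplit : α ^ k = α ^ (k - 1) * α := by
        conv_lhs => rw [show k = (k - 1) + 1 by omega, pow_succ]
      rw [hsplit, Real.rpow_inv_natCast_pow ha0 (by omega)]
      exact mul_rpow_inv_le ha0 hk1
    linarith
  have := mul_le_mul_of_nonneg_left hDk (by positivity : (0 : ℝ) ≤ k ! * M)
  linarith

/-- Chain-rule bound, order `1`: `‖D¹(J ∘ g)(z)‖ ≤ M ‖D¹g(z)‖`. -/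
theorem norm_iteratedFDeriv_one_comp_le {E G : Type*} [NormedAddCommGroup E] [NormedSpace ℝ E]
    [NormedAddCommGroup G] [NormedSpace ℝ G] {J : E → G} {g : ℂ → E} (hJ : ContDiff ℝ ∞ J)
    (hg : ContDiff ℝ ∞ g) {M : ℝ} (z : ℂ) (hM : ∀ i, i ≤ 1 → ‖iteratedFDeriv ℝ i J (g z)‖ ≤ M) :
    ‖iteratedFDeriv ℝ 1 (fun y => J (g y)) z‖ ≤ M * ‖iteratedFDeriv ℝ 1 g z‖ := by
  have h := norm_iteratedFDeriv_comp_le (N := ∞) (n := 1) hJ hg (mod_cast le_top) z hM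
    (D := ‖iteratedFDeriv ℝ 1 g z‖) (fun i hi1 hi2 => by
      obtain rfl : i = 1 := le_antisymm hi2 hi1
      rw [pow_one])
  have hcomp : (fun y => J (g y)) = J ∘ g := rfl
  rw [hcomp]
  simpa using h


/-! ### The pointwise source bound with frozen lower orders -/

/-- The constant of `source_le` is nonnegative. -/
theorem srcConst_nonneg (n : ℕ) {M S : ℝ} (hM : 0 ≤ M) (hS : 0 ≤ S) :
    0 ≤ ∑ j ∈ Finset.range n,
      (n.choose (j + 1) : ℝ) * (j + 1)! * M * (S ^ (j + 1) + 1 + S ^ 2 + S) * (2 * S) := by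
  positivity

/-- **Pointwise bound for the commutator source term.** With `A = J ∘ g`, `p = ∂₁ g`,
`a_j = ‖Dʲg(z)‖`: if `‖DⁱJ(g z)‖ ≤ M` (`i ≤ n`), `a_1 ≤ 2`, and the orders `1 ≤ i ≤ n - 2` are
frozen (`a_i ≤ S`, `S ≥ 2`), then
`‖Dⁿ(A p)(z) - A(z) ∘ Dⁿp(z)‖ ≤ C(n, M, S) (1 + a_{n-1}² + a_n)`. -/
theorem source_le {E : Type*} [NormedAddCommGroup E] [NormedSpace ℝ E] {J : E → E →L[ℝ] E}
    {g : ℂ → E} (hJs : ContDiff ℝ ∞ J) (hg : ContDiff ℝ ∞ g) {n : ℕ} (hn : 1 ≤ n) {M S : ℝ}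
    (hS : 2 ≤ S) (z : ℂ) (hM : ∀ i, i ≤ n → ‖iteratedFDeriv ℝ i J (g z)‖ ≤ M)
    (h1 : ‖iteratedFDeriv ℝ 1 g z‖ ≤ 2)
    (hlow : ∀ i, 1 ≤ i → i + 2 ≤ n → ‖iteratedFDeriv ℝ i g z‖ ≤ S) :
    ‖iteratedFDeriv ℝ n (fun y => J (g y) (fderiv ℝ g y 1)) z -
        (J (g z)).compContinuousMultilinearMap (iteratedFDeriv ℝ n (fderiv ℝ g · 1) z)‖ ≤
      (∑ j ∈ Finset.range n,
        (n.choose (j + 1) : ℝ) * (j + 1)! * M * (S ^ (j + 1) + 1 + S ^ 2 + S) * (2 * S)) *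
      (1 + ‖iteratedFDeriv ℝ (n - 1) g z‖ ^ 2 + ‖iteratedFDeriv ℝ n g z‖) := by
  have hM0 : 0 ≤ M := (norm_nonneg _).trans (hM 0 (Nat.zero_le _))
  have hS1 : 1 ≤ S := by linarith
  have hS0 : 0 ≤ S := by linarith
  have hA : ContDiff ℝ ∞ (fun y => J (g y)) := hJs.comp hg
  have hp : ContDiff ℝ ∞ (fderiv ℝ g · 1) := contDiff_fderiv_apply hg 1
  set a : ℕ → ℝ := fun j => ‖iteratedFDeriv ℝ j g z‖ with ha_def
  have ha0 : ∀ j, 0 ≤ a j := fun j => norm_nonneg _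
  set Λ := 1 + a (n - 1) ^ 2 + a n with hΛ
  have hΛ1 : 1 ≤ Λ := by
    have := ha0 (n - 1); have := ha0 n; simp only [hΛ]; nlinarith
  have han : a n ≤ Λ := by have := ha0 (n - 1); simp only [hΛ]; nlinarith
  have han1 : a (n - 1) ≤ Λ := by
    have := ha0 (n - 1); have := ha0 n; simp only [hΛ]; nlinarith
  refine (norm_commutator_le hA hp n z).trans ?_
  rw [Finset.sum_mul]
  refine Finset.sum_le_sum fun j hj => ?_
  have hjn : j < n := Finset.mem_range.mp hj
  -- the second factor: `‖D^{n-(j+1)} p‖ ≤ a (n - j)`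
  have hY : ‖iteratedFDeriv ℝ (n - (j + 1)) (fderiv ℝ g · 1) z‖ ≤ a (n - j) := by
    have h := norm_iteratedFDeriv_fderiv_apply_le hg 1 (n - (j + 1)) z
    rw [norm_one, one_mul] at h
    have hidx : n - j = n - (j + 1) + 1 := by omega
    rw [hidx]
    exact h
  have hY0 : 0 ≤ ‖iteratedFDeriv ℝ (n - (j + 1)) (fderiv ℝ g · 1) z‖ := norm_nonneg _
  have hX0 : 0 ≤ ‖iteratedFDeriv ℝ (j + 1) (fun y => J (g y)) z‖ := norm_nonneg _
  have hc0 : (0 : ℝ) ≤ (n.choose (j + 1) : ℝ) := by positivity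
  have hfac1 : (1 : ℝ) ≤ (j + 1)! := by exact_mod_cast Nat.one_le_iff_ne_zero.mpr (Nat.factorial_ne_zero _)
  have hPS : 0 ≤ S ^ (j + 1) := pow_nonneg hS0 _
  -- it suffices to bound `X * Y` by `(j+1)! M (S^(j+1) + 1 + S^2 + S) (2 S) Λ`
  suffices key : ‖iteratedFDeriv ℝ (j + 1) (fun y => J (g y)) z‖ *
      ‖iteratedFDeriv ℝ (n - (j + 1)) (fderiv ℝ g · 1) z‖ ≤
      (j + 1)! * M * (S ^ (j + 1) + 1 + S ^ 2 + S) * (2 * S) * Λ by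
    have := mul_le_mul_of_nonneg_left key hc0
    nlinarith [this]
  rcases Nat.eq_zero_or_pos j with hj0 | hjpos
  · -- `j = 0`: chain rule, `‖D¹A‖ ≤ M a₁ ≤ 2M`, second factor `a n ≤ Λ`
    subst hj0
    have hX : ‖iteratedFDeriv ℝ 1 (fun y => J (g y)) z‖ ≤ M * 2 :=
      (norm_iteratedFDeriv_one_comp_le hJs hg z fun i hi => hM i (hi.trans hn)).trans
        (mul_le_mul_of_nonneg_left h1 hM0)
    have hY' : ‖iteratedFDeriv ℝ (n - (0 + 1)) (fderiv ℝ g · 1) z‖ ≤ Λ := hY.trans (by simpa using han)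
    calc ‖iteratedFDeriv ℝ (0 + 1) (fun y => J (g y)) z‖ * ‖iteratedFDeriv ℝ (n - (0 + 1)) (fderiv ℝ g · 1) z‖
        ≤ (M * 2) * Λ := mul_le_mul hX hY' hY0 (by positivity)
      _ ≤ (0 + 1)! * M * (S ^ (0 + 1) + 1 + S ^ 2 + S) * (2 * S) * Λ := by
        apply mul_le_mul_of_nonneg_right _ (by linarith)
        simp only [zero_add, Nat.factorial_one, Nat.cast_one, one_mul, pow_one]
        have h2 : 2 ≤ (S + 1 + S ^ 2 + S) * (2 * S) := by nlinarith [sq_nonneg S]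
        have h3 := mul_le_mul_of_nonneg_left h2 hM0
        linarith
  · -- `j ≥ 1`: frozen Faà di Bruno at order `j + 1 ≥ 2`
    have hX : ‖iteratedFDeriv ℝ (j + 1) (fun y => J (g y)) z‖ ≤
        (j + 1)! * M * (S ^ (j + 1) + 1 + a j ^ 2 + a (j + 1)) := by
      have h := norm_iteratedFDeriv_comp_le_frozen hJs hg (k := j + 1) (by omega) hS1 z
        (fun i hi => hM i (by omega)) (fun i hi1 hi2 => hlow i hi1 (by omega))
      exact h
    have hfM : 0 ≤ ((j + 1)! : ℝ) * M := by positivity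
    generalize hP : S ^ (j + 1) = P at hX hPS
    -- reduce to an inequality between the two brackets
    suffices key2 : (P + 1 + a j ^ 2 + a (j + 1)) * a (n - j) ≤
        (P + 1 + S ^ 2 + S) * (2 * S) * Λ by
      calc ‖iteratedFDeriv ℝ (j + 1) (fun y => J (g y)) z‖ * ‖iteratedFDeriv ℝ (n - (j + 1)) (fderiv ℝ g · 1) z‖
          ≤ ((j + 1)! * M * (P + 1 + a j ^ 2 + a (j + 1))) * a (n - j) :=
            mul_le_mul hX hY hY0 (by positivity)
        _ = ((j + 1)! * M) * ((P + 1 + a j ^ 2 + a (j + 1)) * a (n - j)) := by ring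
        _ ≤ ((j + 1)! * M) * ((P + 1 + S ^ 2 + S) * (2 * S) * Λ) :=
            mul_le_mul_of_nonneg_left key2 hfM
        _ = (j + 1)! * M * (P + 1 + S ^ 2 + S) * (2 * S) * Λ := by ring
    have hP0 : 0 ≤ P := hPS
    have hΛ0 : 0 ≤ Λ := zero_le_one.trans hΛ1
    have hB0 : 0 ≤ P + 1 + S ^ 2 + S := by positivity
    rcases Nat.lt_or_ge (j + 1) n with hlt | hge
    · rcases Nat.lt_or_ge (j + 2) n with hlt2 | hge2
      · -- Case A, `j + 3 ≤ n`: `a j, a (j+1) ≤ S`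
        have haj : a j ≤ S := hlow j hjpos (by omega)
        have haj1 : a (j + 1) ≤ S := hlow (j + 1) (by omega) (by omega)
        have hbr : P + 1 + a j ^ 2 + a (j + 1) ≤ P + 1 + S ^ 2 + S := by
          have := pow_le_pow_left₀ (ha0 j) haj 2
          linarith
        have hbr0 : 0 ≤ P + 1 + a j ^ 2 + a (j + 1) := by positivity
        rcases Nat.lt_or_ge 1 j with hj2 | hj1
        · -- `j ≥ 2`: `a (n - j) ≤ S`
          have hanj : a (n - j) ≤ S := hlow (n - j) (by omega) (by omega)
          calc (P + 1 + a j ^ 2 + a (j + 1)) * a (n - j) ≤ (P + 1 + S ^ 2 + S) * S :=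
                mul_le_mul hbr hanj (ha0 _) hB0
            _ ≤ (P + 1 + S ^ 2 + S) * S * (2 * Λ) :=
                le_mul_of_one_le_right (by positivity) (by linarith)
            _ = (P + 1 + S ^ 2 + S) * (2 * S) * Λ := by ring
        · -- `j = 1`: `a (n - 1) ≤ Λ`
          have e : a (n - j) = a (n - 1) := by congr 1; omega
          calc (P + 1 + a j ^ 2 + a (j + 1)) * a (n - j) ≤ (P + 1 + S ^ 2 + S) * Λ := by
                rw [e]; exact mul_le_mul hbr han1 (ha0 _) hB0
            _ ≤ (P + 1 + S ^ 2 + S) * Λ * (2 * S) :=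
                le_mul_of_one_le_right (by positivity) (by linarith)
            _ = (P + 1 + S ^ 2 + S) * (2 * S) * Λ := by ring
      · -- Case B, `j + 2 = n`: the second factor is `a 2`, and `a (j + 1) = a (n - 1) ≤ Λ`
        have e1 : a (j + 1) = a (n - 1) := by congr 1; omega
        rcases Nat.lt_or_ge 1 j with hj2 | hj1
        · -- `j ≥ 2` (`n ≥ 4`): `a j ≤ S`, `a (n - j) = a 2 ≤ S`
          have haj : a j ≤ S := hlow j hjpos (by omega)
          have hanj : a (n - j) ≤ S := hlow (n - j) (by omega) (by omega)
          have hsq : a j ^ 2 ≤ S ^ 2 := pow_le_pow_left₀ (ha0 j) haj 2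
          have hbr : P + 1 + a j ^ 2 + a (j + 1) ≤ P + 1 + S ^ 2 + Λ := by rw [e1]; linarith
          calc (P + 1 + a j ^ 2 + a (j + 1)) * a (n - j) ≤ (P + 1 + S ^ 2 + Λ) * S :=
                mul_le_mul hbr hanj (ha0 _) (by positivity)
            _ = (P + 1 + S ^ 2) * S + Λ * S := by ring
            _ ≤ (P + 1 + S ^ 2) * S * Λ + Λ * S := by
                have : (P + 1 + S ^ 2) * S ≤ (P + 1 + S ^ 2) * S * Λ :=
                  le_mul_of_one_le_right (by positivity) hΛ1
                linarith
            _ = (P + 2 + S ^ 2) * S * Λ := by ring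
            _ ≤ (P + 1 + S ^ 2 + S) * (2 * S) * Λ := by
                apply mul_le_mul_of_nonneg_right _ hΛ0
                nlinarith
        · -- `j = 1` (`n = 3`): `a j = a 1 ≤ 2 ≤ S`, `a (n - j) = a (n - 1) ≤ Λ`, `a (n-1)² ≤ Λ`
          have e0 : a j = a 1 := by congr 1; omega
          have e2 : a (n - j) = a (n - 1) := by congr 1; omega
          have hsq : a j ^ 2 ≤ S ^ 2 := by
            rw [e0]; exact pow_le_pow_left₀ (ha0 1) (h1.trans hS) 2
          have hxx : a (n - 1) * a (n - 1) ≤ Λ := by have := ha0 n; rw [hΛ]; nlinarith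
          have hx1 : (P + 1) * a (n - 1) ≤ (P + 1) * Λ := mul_le_mul_of_nonneg_left han1 (by positivity)
          have hx2 : a j ^ 2 * a (n - 1) ≤ S ^ 2 * Λ := mul_le_mul hsq han1 (ha0 _) (by positivity)
          calc (P + 1 + a j ^ 2 + a (j + 1)) * a (n - j)
              = (P + 1) * a (n - 1) + a j ^ 2 * a (n - 1) + a (n - 1) * a (n - 1) := by
                rw [e1, e2]; ring
            _ ≤ (P + 1) * Λ + S ^ 2 * Λ + Λ := by linarith
            _ = (P + 2 + S ^ 2) * Λ := by ring
            _ ≤ (P + 1 + S ^ 2 + S) * (2 * S) * Λ := by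
                apply mul_le_mul_of_nonneg_right _ hΛ0
                nlinarith
    · -- Case C, `j + 1 = n`: top order; the second factor is `a 1 ≤ 2`
      have e0 : a j = a (n - 1) := by congr 1; omega
      have e1 : a (j + 1) = a n := by congr 1; omega
      have hbr : P + 1 + a j ^ 2 + a (j + 1) ≤ (P + 1) * Λ := by
        rw [e0, e1, hΛ]
        have := mul_nonneg hP0 (add_nonneg (sq_nonneg (a (n - 1))) (ha0 n))
        nlinarith
      have h3 : (P + 1) * 2 ≤ (P + 1 + S ^ 2 + S) * (2 * S) :=
        calc (P + 1) * 2 ≤ (P + 1) * (2 * S) :=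
              mul_le_mul_of_nonneg_left (by linarith only [hS]) (by linarith only [hP0])
          _ ≤ (P + 1 + S ^ 2 + S) * (2 * S) :=
              mul_le_mul_of_nonneg_right (by linarith only [sq_nonneg S, hS0])
                (by linarith only [hS0])
      have hfin : (P + 1) * Λ * 2 ≤ (P + 1 + S ^ 2 + S) * (2 * S) * Λ :=
        calc (P + 1) * Λ * 2 = (P + 1) * 2 * Λ := by ring
          _ ≤ (P + 1 + S ^ 2 + S) * (2 * S) * Λ := mul_le_mul_of_nonneg_right h3 hΛ0
      have hpos : 0 ≤ (P + 1) * Λ := mul_nonneg (by linarith only [hP0]) hΛ0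
      have e2 : a (n - j) = a 1 := by congr 1; omega
      have h1a : a 1 ≤ 2 := h1
      rw [e2]
      exact (mul_le_mul hbr h1a (ha0 1) hpos).trans hfin

end Apriori

end Summit.SmoothPoincare4.SmoothPoincare4.Cruxes.TameOrBrodyR4.Sketch
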